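import Summits.NavierStokesRegularity.NavierStokesRegularity.Theorems.SelfMixingDichotomyCoherentScaleExclusionSelfSimilarSwirlLoadCeiling
import HarnessLib

/-!
# Route SelfMixingDichotomy — crux `SequentialTypeIExclusion` (stmt-NavierStokesRegularity-1424),
# line `registered`, lead c6 (pulsating witness package): stub `pulse_windowCeiling` (W3)

Support file (`--supports stmt-NavierStokesRegularity-1424`) landing the registered stub
`pulse_windowCeiling` of the lead's pulsating kinematic witness

`u t x = (a t · (1 - t)⁻¹ · expNegInvGlue (4 - ‖x‖² / (1 - t))) • (-x₁, x₀, 0)` (`t < 1`; `0` after),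

the regime-A self-similar swirling eddy of the sibling crux S2 with a time-dependent amplitude
`a : ℝ → ℝ`. This file proves the LOAD CEILING AT A WINDOW SCALE `w > 0`: if `0 ≤ a` before the
blow-up time and the amplitude cube sits below the window majorant,
`(a t)³ ≤ K w (1 - t)^{-1/2}` for `t ∈ (1 - w², 1)`, then the Caffarelli–Kohn–Nirenberg scaled
cubic load on the backward parabolic cylinder `Q_w(1, 0) = (1 - w², 1) × B_w(0)` obeys

`cknC w (1, 0) u ≤ ofReal (128 K |B₁|)`.

Proof. At each fixed `t < 1` the slice is S2's slice with `A := a t`, so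
`∫ ‖u t ·‖ₑ³ ≤ ofReal (64 (a t)³) |B₁| ≤ ofReal (64 K w (1 - t)^{-1/2}) |B₁|`
(`selfSimilarSwirl_loadCeiling_lintegral_slice_le`). Tonelli's inequality `lintegral_prod_le` on
`Q_w(1, 0) = Ioo (1 - w²) 1 ×ˢ ball 0 w` and the elementary integral
`∫_{1-w²}^{1} (1 - t)^{-1/2} dt = 2w` (`integral_rpow` after `integral_comp_sub_left`) give
`∫∫_{Q_w} ‖u‖ₑ³ ≤ ofReal (128 K w²) |B₁|`, and the prefactor `(ofReal w ^ 2)⁻¹` cancels.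

Mathlib only plus the tree lemma `selfSimilarSwirl_loadCeiling_lintegral_slice_le`; no named fact
is taken as a hypothesis, no definition, no notation. The neighbouring stubs of the package are
neither used nor restated.
-/

noncomputable section

open MeasureTheory Set Metric
open scoped ENNReal ContDiff
open Literature.Analysis.FluidPDE

set_option linter.dupNamespace false

namespace Summit.NavierStokesRegularity.NavierStokesRegularity.Theorems.SequentialTypeIExclusion.Registered

/-- The elementary window integral: `∫_{(1 - w², 1)} (1 - t)^{-1/2} dt = 2 w` for `w > 0`
(substitute `s = 1 - t`, then `∫₀^{w²} s^{-1/2} ds = 2 (w²)^{1/2} = 2w`). [folklore] -/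
theorem pulse_windowCeiling_integral_Ioo {w : ℝ} (hw : 0 < w) :
    ∫ t in Ioo (1 - w ^ 2) 1, (1 - t) ^ (-(1 / 2 : ℝ)) = 2 * w := by
  have hle : 1 - w ^ 2 ≤ 1 := sub_le_self _ (sq_nonneg w)
  rw [← integral_Ioc_eq_integral_Ioo, ← intervalIntegral.integral_of_le hle,
    intervalIntegral.integral_comp_sub_left (fun t : ℝ => t ^ (-(1 / 2 : ℝ))) 1, sub_self,
    sub_sub_cancel, integral_rpow (Or.inl (by norm_num : (-1 : ℝ) < -(1 / 2)))]
  rw [show (-(1 / 2 : ℝ)) + 1 = 1 / 2 by norm_num, Real.zero_rpow (by norm_num : (1 / 2 : ℝ) ≠ 0),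
    ← Real.sqrt_eq_rpow, Real.sqrt_sq hw.le, sub_zero]
  ring

/-- The window majorant `t ↦ (1 - t)^{-1/2}` is integrable on `(1 - w², 1)` (an `rpow` with
exponent `> -1`, singular only at the right endpoint). [folklore] -/
theorem pulse_windowCeiling_integrableOn (w : ℝ) :
    IntegrableOn (fun t : ℝ => (1 - t) ^ (-(1 / 2 : ℝ))) (Ioo (1 - w ^ 2) 1) := by
  have hle : 1 - w ^ 2 ≤ 1 := sub_le_self _ (sq_nonneg w)
  have h := (intervalIntegral.intervalIntegrable_rpow' (a := w ^ 2) (b := 0)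
    (by norm_num : (-1 : ℝ) < -(1 / 2))).comp_sub_left 1
  rw [sub_zero, intervalIntegrable_iff_integrableOn_Ioc_of_le hle] at h
  exact h.mono_set Ioo_subset_Ioc_self

/-- The time integral of the window majorant in `ℝ≥0∞` form:
`∫⁻_{(1 - w², 1)} ofReal (c (1 - t)^{-1/2}) = ofReal (c · 2w)` for `c ≥ 0`, `w > 0`. [folklore] -/
theorem pulse_windowCeiling_lintegral_majorant {c w : ℝ} (hc : 0 ≤ c) (hw : 0 < w) :
    ∫⁻ t in Ioo (1 - w ^ 2) 1, ENNReal.ofReal (c * (1 - t) ^ (-(1 / 2 : ℝ))) =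
      ENNReal.ofReal (c * (2 * w)) := by
  have hfi : IntegrableOn (fun t : ℝ => c * (1 - t) ^ (-(1 / 2 : ℝ))) (Ioo (1 - w ^ 2) 1) :=
    Integrable.const_mul (pulse_windowCeiling_integrableOn w) c
  have hnn : 0 ≤ᵐ[volume.restrict (Ioo (1 - w ^ 2) 1)]
      fun t : ℝ => c * (1 - t) ^ (-(1 / 2 : ℝ)) := by
    filter_upwards [self_mem_ae_restrict
      (measurableSet_Ioo : MeasurableSet (Ioo (1 - w ^ 2) (1 : ℝ)))] with t ht
    exact mul_nonneg hc (Real.rpow_nonneg (sub_pos.2 ht.2).le _)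
  rw [← ofReal_integral_eq_lintegral_ofReal hfi hnn, integral_const_mul,
    pulse_windowCeiling_integral_Ioo hw]

/-- **W3 — load ceiling at a window scale (registered stub `pulse_windowCeiling` of the crux
`SequentialTypeIExclusion`, line `registered`, lead c6).** If `0 ≤ a` before `t = 1` and
`(a t)³ ≤ K w (1 - t)^{-1/2}` on the window `t ∈ (1 - w², 1)`, then `C(w; 1, 0) ≤ 128 K |B₁|`:
every slice has `∫ ‖u t ·‖ₑ³ ≤ ofReal (64 (a t)³) |B₁|`
(`selfSimilarSwirl_loadCeiling_lintegral_slice_le` with `A = a t`), Tonelli on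
`Q_w(1, 0) = (1 - w², 1) × B_w`, `∫_{1-w²}^{1} (1 - t)^{-1/2} dt = 2w`, and `(ofReal w²)⁻¹`
cancels. [folklore] -/
theorem pulse_windowCeiling :
    ∀ (a : ℝ → ℝ) (w K : ℝ), 0 < w → 0 ≤ K → (∀ t : ℝ, t < 1 → 0 ≤ a t) →
      (∀ t ∈ Set.Ioo (1 - w ^ 2) 1, a t ^ 3 ≤ K * w * (1 - t) ^ (-(1 / 2 : ℝ))) →
      Literature.Analysis.FluidPDE.cknC w (((1 : ℝ), (0 : EuclideanSpace ℝ (Fin 3))) : ℝ × EuclideanSpace ℝ (Fin 3))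
          (fun (t : ℝ) (x : EuclideanSpace ℝ (Fin 3)) => if t < 1 then
            (a t * (1 - t)⁻¹ * expNegInvGlue (4 - ‖x‖ ^ 2 / (1 - t))) •
              (WithLp.toLp 2 ![-(x 1), x 0, 0] : EuclideanSpace ℝ (Fin 3)) else 0) ≤
        ENNReal.ofReal (128 * K * (MeasureTheory.volume (Metric.ball (0 : EuclideanSpace ℝ (Fin 3)) 1)).toReal) := by
  intro a w K hw hK ha hmaj
  -- the unit-ball volume `V = |B₁| < ∞` and the constant `c = 64 K w ≥ 0`
  set V : ℝ≥0∞ := volume (ball (0 : EuclideanSpace ℝ (Fin 3)) 1) with hV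
  have hvtop : V ≠ ⊤ := measure_ball_lt_top.ne
  set c : ℝ := 64 * (K * w) with hc
  have hc0 : 0 ≤ c := by rw [hc]; positivity
  -- the centre `z = (1, 0)` and the field `u`
  set z : ℝ × EuclideanSpace ℝ (Fin 3) := ((1 : ℝ), (0 : EuclideanSpace ℝ (Fin 3))) with hz
  set u : ℝ → EuclideanSpace ℝ (Fin 3) → EuclideanSpace ℝ (Fin 3) := fun t x =>
    if t < 1 then
      (a t * (1 - t)⁻¹ * expNegInvGlue (4 - ‖x‖ ^ 2 / (1 - t))) •
        (WithLp.toLp 2 ![-(x 1), x 0, 0] : EuclideanSpace ℝ (Fin 3))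
    else 0 with hu
  -- slices in the window: `∫ ‖u t ·‖ₑ³ ≤ ofReal (c (1 - t)^{-1/2}) V`
  have hslice : ∀ t ∈ Ioo (1 - w ^ 2) 1,
      ∫⁻ x, ‖u t x‖ₑ ^ (3 : ℕ) ≤ ENNReal.ofReal (c * (1 - t) ^ (-(1 / 2 : ℝ))) * V := by
    intro t ht
    have ht1 : t < 1 := ht.2
    have hτ : 0 < 1 - t := sub_pos.2 ht1
    simp only [hu, if_pos ht1]
    refine (selfSimilarSwirl_loadCeiling_lintegral_slice_le (ha t ht1) hτ).trans ?_
    refine mul_le_mul' (ENNReal.ofReal_le_ofReal ?_) le_rfl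
    have h1 := hmaj t ht
    calc 64 * a t ^ 3 ≤ 64 * (K * w * (1 - t) ^ (-(1 / 2 : ℝ))) := by linarith
      _ = c * (1 - t) ^ (-(1 / 2 : ℝ)) := by rw [hc]; ring
  -- the space–time integral over `Q_w(1, 0) = (1 - w², 1) × B_w(0)` by Tonelli's inequality
  have hQ : parabolicCylinder w z =
      Ioo (1 - w ^ 2) 1 ×ˢ ball (0 : EuclideanSpace ℝ (Fin 3)) w := rfl
  have hint : ∫⁻ q in parabolicCylinder w z, ‖u q.1 q.2‖ₑ ^ (3 : ℕ) ≤
      ENNReal.ofReal (c * (2 * w)) * V := by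
    rw [hQ, Measure.volume_eq_prod, ← Measure.prod_restrict]
    refine (lintegral_prod_le _).trans ?_
    calc ∫⁻ t in Ioo (1 - w ^ 2) 1, ∫⁻ x in ball (0 : EuclideanSpace ℝ (Fin 3)) w,
          ‖u (t, x).1 (t, x).2‖ₑ ^ (3 : ℕ)
        ≤ ∫⁻ t in Ioo (1 - w ^ 2) 1, ENNReal.ofReal (c * (1 - t) ^ (-(1 / 2 : ℝ))) * V := by
          refine setLIntegral_mono' measurableSet_Ioo fun t ht => ?_
          exact (setLIntegral_le_lintegral _ _).trans (hslice t ht)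
      _ = (∫⁻ t in Ioo (1 - w ^ 2) 1, ENNReal.ofReal (c * (1 - t) ^ (-(1 / 2 : ℝ)))) * V :=
          lintegral_mul_const' _ _ hvtop
      _ = ENNReal.ofReal (c * (2 * w)) * V := by
          rw [pulse_windowCeiling_lintegral_majorant hc0 hw]
  -- assemble: `cknC = (ofReal w ^ 2)⁻¹ · ∫∫ ≤ (ofReal w ^ 2)⁻¹ · (ofReal w ^ 2 · ofReal (128 K) · V)`
  have h0 : ENNReal.ofReal w ^ 2 ≠ 0 := pow_ne_zero _ (ENNReal.ofReal_pos.2 hw).ne'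
  have htop : ENNReal.ofReal w ^ 2 ≠ ⊤ := ENNReal.pow_ne_top ENNReal.ofReal_ne_top
  have hcw : c * (2 * w) = w ^ 2 * (128 * K) := by rw [hc]; ring
  have hK' : (0 : ℝ) ≤ 128 * K := by positivity
  calc cknC w z u
      = (ENNReal.ofReal w ^ 2)⁻¹ * ∫⁻ q in parabolicCylinder w z, ‖u q.1 q.2‖ₑ ^ (3 : ℕ) :=
        rfl
    _ ≤ (ENNReal.ofReal w ^ 2)⁻¹ * (ENNReal.ofReal (c * (2 * w)) * V) := mul_le_mul' le_rfl hint
    _ = ENNReal.ofReal (128 * K) * V := by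
        rw [hcw, ENNReal.ofReal_mul (sq_nonneg w), ENNReal.ofReal_pow hw.le, ← mul_assoc,
          ← mul_assoc, ENNReal.inv_mul_cancel h0 htop, one_mul]
    _ = ENNReal.ofReal (128 * K * V.toReal) := by
        rw [ENNReal.ofReal_mul hK', ENNReal.ofReal_toReal hvtop]

end Summit.NavierStokesRegularity.NavierStokesRegularity.Theorems.SequentialTypeIExclusion.Registered

end
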